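import Mathlib
import Summits.ValiantsHypothesis.ValiantsHypothesis.Theorems.GrenetZeonPolySizeQPAlgebraLocalReductionResidualThree
import HarnessLib

/-!
# Crux `GrenetZeon.PolySizeQPAlgebra` (stmt-ValiantsHypothesis-8064), line `vbp-slice-dealg` —
# the all-large-`n` reduction with the local Hessian bound required only for large `n`

`corner_all_large_of_localHessianBound₃` (`…LocalReductionResidualThree`) asks for the residual-corank-`≥ 3`
local Hessian bound `LocalHessianBound₃ n` at EVERY `n`, although its conclusion is an all-large-`n`
statement and the bound is used only at the `n` in question.  Type-specific rank counts at residual corank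
`3 ≤ q ≤ ν` (the window left open by `…OutsideWindow`) typically hold only above a threshold in `n`
(e.g. `ℂ[x,y]/(x²,y²)` at `q = 3`: crude counts need `n ≥ 6`).  This file records the by-name variant with
the hypothesis only for `n ≥ n₁`:

* `corner_all_large_of_localHessianBound₃_eventually` — `LocalHessianBound₃ n` for all `n ≥ n₁` and good
  `(s+1)`-spaces with threshold `2sn` for all large `n` empty the column `(m, s') ≤ (n, s)` of the `c = 1`
  box for all large `n`.

HONEST FRAMING: bookkeeping; no stub of the line is closed; VP ≠ VNP is not moved.

References: T. Mignon, N. Ressayre, IMRN 2004:79, §2 [MignonRessayre2004].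
-/

noncomputable section

open MvPolynomial Matrix
open Literature.Computability.AlgebraicComplexity

-- single-conjunct layout `Summits/ValiantsHypothesis/ValiantsHypothesis`: duplicated namespace by design
set_option linter.dupNamespace false

namespace Summit.ValiantsHypothesis.ValiantsHypothesis.Theorems.GrenetZeonPolySizeQPAlgebra

/-- **All large `n`, every fixed `s`, from `LocalHessianBound₃` at large `n` only.**  If the
residual-corank-`≥ 3` local Hessian bound holds at every `n ≥ n₁` and good `(s+1)`-spaces with threshold
`2sn` exist for all large `n`, then for all large `n` no `(m, s') ≤ (n, s)` representation of `per_n`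
exists. [folklore] -/
theorem corner_all_large_of_localHessianBound₃_eventually (s n₁ : ℕ)
    (hH₃ : ∀ n : ℕ, n₁ ≤ n → ∀ (R : Type) [CommRing R] [Algebra ℂ R] [Module.Finite ℂ R] (φ : R →ₐ[ℂ] ℂ)
      (ν : ℕ), RingHom.ker (φ : R →+* ℂ) ^ ν = ⊥ →
      ∀ (l : R →ₗ[ℂ] ℂ), (∀ r : R, (∀ x, l (x * r) = 0) → r = 0) →
      ∀ (A : Matrix (Fin n) (Fin n) (MvPolynomial (Fin n × Fin n) R)) (F : MvPolynomial (Fin n × Fin n) ℂ),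
        (∀ a b, (A a b).IsHomogeneous 1) → (∀ d, l (coeff d A.det) = coeff d F) →
        ∀ p : Fin n × Fin n → ℂ, eval (fun i => algebraMap ℂ R (p i)) A.det = 0 →
          (∀ r c : Fin (n - 2) → Fin n,
            φ ((A.map (eval (fun i => algebraMap ℂ R (p i)))).submatrix r c).det = 0) →
          (hess0 (transl p F)).rank ≤ 2 * Module.finrank ℂ R * n)
    (hW : ∃ n₀ : ℕ, ∀ n ≥ n₀, ∃ w : Fin (s + 1) → (Fin n × Fin n → ℂ), LinearIndependent ℂ w ∧
      ∀ a : Fin (s + 1) → ℂ, a ≠ 0 → eval (∑ i, a i • w i) (perPoly (Fin n) ℂ) = 0 →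
        2 * s * n < (hess0 (transl (∑ i, a i • w i) (perPoly (Fin n) ℂ))).rank) :
    ∃ n₀ : ℕ, ∀ n ≥ n₀, ∀ m s' : ℕ, m ≤ n → s' ≤ s → ¬ HasAlgDetRepr (perPoly (Fin n) ℂ) m s' := by
  obtain ⟨n₀, hgood⟩ := hW
  refine ⟨max (max n₀ 1) n₁, fun n hn m s' hm hs' hrep => ?_⟩
  have hn₀ : n₀ ≤ n := le_trans (le_max_left _ _) (le_trans (le_max_left _ _) hn)
  have hn1 : 1 ≤ n := le_trans (le_max_right _ _) (le_trans (le_max_left _ _) hn)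
  have hnn₁ : n₁ ≤ n := le_trans (le_max_right _ _) hn
  exact not_hasAlgDetRepr_perPoly_self_of_localHessianBound₃ hn1 (hH₃ n hnn₁) (hgood n hn₀)
    (Nat.lt_succ_self s) le_rfl (hrep.mono hm hs')

end Summit.ValiantsHypothesis.ValiantsHypothesis.Theorems.GrenetZeonPolySizeQPAlgebra

end
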